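import Literature.AnabelianGeometry.EtaleTheta.Discharge.Sec5ThetaSubquotientRhoOfConnectedTemperoid
import Literature.AnabelianGeometry.EtaleTheta.ThetaSubquotientLevelN
import Literature.AnabelianGeometry.EtaleTheta.Thm56SubdagStatements

/-!
# [EtTh] §5: the coverage input `LDeltaCovered` of Prop. 5.5 / Thm. 5.6 (i) / Thm. 5.7 (C) is a THEOREM at the R2 carrier — generic, and at the genuine level-`N` data under the two pins (proof-only)

Mochizuki, *The étale theta function and its Frobenioid-theoretic manifestations*, Publ. RIMS **45** (2009), §1 p. 238 (PDF p. 12)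
(«`1 → Δ_Θ → (Δ^tp_Y)^Θ → (Δ^tp_Y)^ell → 1`»: `Δ_Θ`, hence `l·Δ_Θ` and `(l·Δ_Θ) ⊗ ℤ/N ≅ μ_N` (§2 p. 46), is a quotient of a subgroup of
`Π^tp_Ÿ`), §5 p. 327 (PDF p. 101) («these subquotients determine subquotients `Aut_D(D) ↠ Aut^Θ_D(D)`; `(l·Δ_Θ)_D ⊆ Aut^Θ_D(D)`»),
proof of Prop. 5.5 pp. 327–328 (PDF pp. 101–102).  [cite: MochizukiEtTh2009, §5 p.327 (PDF p.101); §1 p.238 (PDF p.12)]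
Seat abc-iut-L2-t9 (gen 5), sequel of my R479 junction file `Sec5Thm57JunctionHK4OfK4.lean` (p458989): its one K4-side residual was
abc-iut-w5-d020's sub-DAG input `Thm56Sub.LDeltaCovered 𝔉 P` («the part of `H_{B_N}` over `(l·Δ_Θ)_{B_N}` maps ONTO `(l·Δ_Θ)_{B_N} ⊗ ℤ/N`»,
= abc-iut-L2-t11's former `hcov`).  abc-iut-w5-d123's `lDeltaCovered_ofBiKummerData` (p419020) derives it MODULO the row-2 binders `hpre`/`hP`
and a surjective coefficient map `e`; here it is derived OUTRIGHT for the R2 carrier (my lineage's `ThetaSubquotient.LDelta q ι` /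
`autPre ↠ autProj`, `ThetaSubquotientOfTempered{,Galois,Aut}.lean`), from abc-iut-w4-d042's base-point laws (`Sec5ThetaSubquotientAutLaws`
p429126, `Sec5ThetaSubquotientRhoOfConnectedTemperoid`).  PROOF-ONLY (0 definitions; nothing restated).

* `ThetaSubquotient.exists_autProj_rho_eq_of_forall_exists` — GENERIC: for a connected `E ∈ B^temp(Π)` with base point `x`, a homomorphism
  `ρ : Γ → Aut E` acting at `x` by right translation through `φ : Γ → Π` (`(ρ k)(x) = (φ k)⁻¹·x`), and a subgroup `H ≤ Γ` with
  «`L ⊆ q(φ(H))`» (print: `l·Δ_Θ ⊆ Π^tp_Ÿ`), EVERY class of `(l·Δ_Θ)_E` is `autProj (ρ k)` for some `k ∈ H` — no Galois hypothesis on `E`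
  (evaluate at `x`: `evalAt_autProj_rho` + `evalAt_injective`);
* `ThetaFrobenioid.exists_autProj_mapAut_rhoOfBiKummerData_eq` — the same at abc-iut-L2-t4's genuine §5 data over `B^temp(Π^tp_X)⁰`
  (`ρ := rhoOfBiKummerData R ιX` read on the underlying `Π^tp_X`-set, base point `(s^⊓_N)^bs(x_{A_N})`, any `(q, ι)`, any `H ≤ Π^tp_X` with
  `L ⊆ q(ιX(H))`);
* `ThetaFrobenioid.lDeltaCovered_levelStub_of_pins` — **`Thm56Sub.LDeltaCovered (ofConnectedTemperoidData h (RD.levelStub ιX) …) P` from the two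
  pins `hPpre` / `hPproj_pin` ALONE** (abc-iut-w4-d042's pins on `P` at `B_N^bs`, VERBATIM as in abc-iut-w5-d034's
  `exists_rigidity_kummerComparisonInputs_levelN`, p450400), any Frobenius-trivial Galois `A_⊙`: `H := Π^tp_Ÿ`, «`ι_N(μ_N) ⊆ q_N(ιX(Π^tp_Ÿ))`» by
  `RigidData.thetaMod_surjective` + `lDeltaTheta_le` + `qN_ιX_eq_iotaN_thetaMod`.  So at the genuine level-`N` data the K4-side input list of
  `kummerComparison_of_thetaSectionCompat_of_rigidity` (p458989) is {the two pins} ∪ {the conjuncts of p450400} — nothing else.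
The `A_⊙^bs := Ÿ` instance (`mkOfConnectedTemperoidYdd`) is the Connected one by `exact` (as in p450400's `…_levelN_Ydd`).
HONEST FRAMING: kernel-checked; whether a `P : ThetaSubquotientProj 𝔉` satisfying the pins exists is NOT asserted (GAP G-w4d042g3-1; cf. my p456572);
nothing about [EtTh]'s curves is asserted; typed ≠ discharged; no side taken on [IUTchIII] Cor. 3.12.
-/

noncomputable section

namespace Literature.AnabelianGeometry.EtaleTheta

open CategoryTheory Opposite FrobenioidCyclotomicRigidity Literature.AlgebraicGeometry.Frobenioids
  Literature.AnabelianGeometry.SemiGraphs Literature.AnabelianGeometry.SemiGraphs.GaloisObjects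
open Literature.AlgebraicGeometry.Frobenioids.QuasiTemperoid (stabilizerSubgroup)

universe u v w u' u₀ v₀ w' v'

/-! ### Generic: coverage of `(l·Δ_Θ)_E` by `autProj ∘ ρ` on a subgroup reaching `L` -/

namespace ThetaSubquotient

variable {G : Type u} [Group G] [TopologicalSpace G] {Q : Type v} [Group Q] {Λ : Type w} [CommGroup Λ]
  (q : G →* Q) (ι : Λ →* Q) {E : BTemp G} (x : E.obj.V) {Γ : Type u'} [Group Γ] (φ : Γ →* G) (ρ : Γ →* Aut E)
  (hρ : ∀ k : Γ, ((ρ k).hom.hom.hom x : E.obj.V) = E.obj.ρ (φ k)⁻¹ x)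

include hρ

/-- **Coverage, generic**: if every `ι a ∈ L` is `q (φ k)` for some `k` in the subgroup `H ≤ Γ` (print: `l·Δ_Θ ⊆ Π^tp_Ÿ`, §1 p.238), then
every class of `(l·Δ_Θ)_E` (connected `E`, base point `x`, `ρ` acting at `x` by right translation through `φ`) is `autProj (ρ k)` for some
`k ∈ H` with `ρ k ∈ autPre`.  [cite: MochizukiEtTh2009, §5 p.327 (PDF p.101); §1 p.238 (PDF p.12)] -/
theorem exists_autProj_rho_eq_of_forall_exists [ι.range.Normal] (hE : IsConnectedObj E) (H : Subgroup Γ)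
    (hL : ∀ a : Λ, ∃ k ∈ H, q (φ k) = ι a) (c : LDelta q ι E) :
    ∃ k ∈ H, ∃ hm : ρ k ∈ autPre q ι E, autProj q ι E ⟨ρ k, hm⟩ = c := by
  obtain ⟨a, ha⟩ := QuotientGroup.mk_surjective (evalAt q ι E x c)
  obtain ⟨k, hk, hqk⟩ := hL a⁻¹
  have hk' : q (φ k) ∈ ι.range := ⟨a⁻¹, hqk.symm⟩
  have hm : ρ k ∈ autPre q ι E := mem_autPre_of_rho_apply_base q ι x φ ρ hρ hE k hk'
  refine ⟨k, hk, hm, evalAt_injective q ι hE x ?_⟩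
  rw [evalAt_autProj_rho q ι x φ ρ hρ k a (by rw [map_inv, hqk, map_inv, inv_inv]) hm, ha]

end ThetaSubquotient

namespace ThetaFrobenioid

/-! ### At the genuine §5 data over `B^temp(Π^tp_X)⁰`, `ρ := rhoOfBiKummerData` -/

section Connected

variable {K : Type u₀} [Field K] {X : SemiGraphs.TemperedArithmeticGroup.{u₀} K} {D₀ : Type u₀} [Category.{v₀} D₀]
  {V : FrdIMonoidStub.{w'}} {T₀ : RealifiedDivisorMonoids (D₀ := D₀) V}
  {VD : FrdICatStub.{u₀ + 1, u₀, w'} (ConnectedPart (BTemp X.Pi))}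
  {tf : TemperedFrobenioid T₀ (ConnectedPart (BTemp X.Pi)) VD} {hZ : tf.monoidType = MonoidType.Z}
  {hP : ∀ A : (ConnectedPart (BTemp X.Pi))ᵒᵖ, IsPerfect (tf.Φ.carrier A)}
  {NH : Subgroup (Field.absoluteGaloisGroup K) → tf.category → ℕ+ → Prop} {A₀ : tf.category}
  {hA₀ : PreFrobenioid.IsFrobeniusTrivial tf.toElem A₀} {hA₀' : SemiGraphs.IsGaloisObj A₀.base.obj}
  {pullFrac : ∀ {A A' : (BiKummerSetting.mkOfConnectedTemperoid X tf hZ hP NH A₀ hA₀ hA₀').C} (_ : A' ⟶ A),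
    (BiKummerSetting.mkOfConnectedTemperoid X tf hZ hP NH A₀ hA₀ hA₀').biratUnits A →
      (BiKummerSetting.mkOfConnectedTemperoid X tf hZ hP NH A₀ hA₀ hA₀').biratUnits A'}
  {lv : ℕ+}
  {θ : (BiKummerSetting.mkOfConnectedTemperoid X tf hZ hP NH A₀ hA₀ hA₀').biratUnits
    (BiKummerSetting.mkOfConnectedTemperoid X tf hZ hP NH A₀ hA₀ hA₀').Aodot}
  {Bl : (BiKummerSetting.mkOfConnectedTemperoid X tf hZ hP NH A₀ hA₀ hA₀').C}
  {Pl : (BiKummerSetting.mkOfConnectedTemperoid X tf hZ hP NH A₀ hA₀ hA₀').FractionPair θ Bl}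
  {Rl : (BiKummerSetting.mkOfConnectedTemperoid X tf hZ hP NH A₀ hA₀ hA₀').NthRoot θ Pl lv pullFrac}
  {N : ℕ+} {T : ThetaEnvData.{max u₀ w'} N}
  (R : (BiKummerSetting.mkOfConnectedTemperoid X tf hZ hP NH A₀ hA₀ hA₀').NthRoot Rl.root Rl.pair N pullFrac)
  (ιX : T.PiX ≃ₜ* X.Pi) {Q' : Type v'} [Group Q'] {Λ : Type w} [CommGroup Λ] (q : X.Pi →* Q') (ι : Λ →* Q')

/-- **Coverage at the genuine data**: for any subgroup `H ≤ Π^tp_X̲` (of the §2 data) with «`L ⊆ q(ιX(H))`», every class of `(l·Δ_Θ)_{B_N^bs}` is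
`autProj (ρ k)` for some `k ∈ H`, `ρ k ∈ P_{B_N^bs} = autPre q ι` (`ρ = rhoOfBiKummerData R ιX` read on the underlying `Π^tp_X`-set; base point
`(s^⊓_N)^bs(x_{A_N})`, abc-iut-w4-d042's `rhoOfBiKummerData_obj_apply_base`).  [cite: MochizukiEtTh2009, §5 p.327 (PDF p.101); §5 p.331 (PDF p.105)] -/
theorem exists_autProj_mapAut_rhoOfBiKummerData_eq [ι.range.Normal] (H : Subgroup T.PiX)
    (hL : ∀ a : Λ, ∃ k ∈ H, q (ιX.toMonoidHom k) = ι a) (c : ThetaSubquotient.LDelta q ι R.BN.base.obj) :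
    ∃ k ∈ H, ∃ hm : ((Functor.mapAut R.BN.base (connectedObjects (BTemp X.Pi)).ι).comp (rhoOfBiKummerData R ιX)) k ∈
        ThetaSubquotient.autPre q ι R.BN.base.obj,
      ThetaSubquotient.autProj q ι R.BN.base.obj ⟨_, hm⟩ = c :=
  ThetaSubquotient.exists_autProj_rho_eq_of_forall_exists q ι
    ((BiKummerSetting.NthRoot.baseIso _ R).hom.hom.hom.hom (galoisBase X.isTempered R.AN.base.obj R.αData.isGalois))
    ιX.toMonoidHom ((Functor.mapAut R.BN.base (connectedObjects (BTemp X.Pi)).ι).comp (rhoOfBiKummerData R ιX))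
    (rhoOfBiKummerData_obj_apply_base R ιX) R.BN.base.property H hL c

end Connected

/-! ### At the genuine level-`N` data (`Q := RD.levelStub ιX`), `P` pinned at `B_N^bs` -/

section LevelN

variable {K : Type u₀} [Field K] {X : SemiGraphs.TemperedArithmeticGroup.{u₀} K} {D₀ : Type u₀} [Category.{v₀} D₀]
  {V : FrdIMonoidStub.{max u₀ w'}} {T₀ : RealifiedDivisorMonoids (D₀ := D₀) V}
  {VD : FrdICatStub.{u₀ + 1, u₀, max u₀ w'} (ConnectedPart (BTemp X.Pi))}
  {tf : TemperedFrobenioid T₀ (ConnectedPart (BTemp X.Pi)) VD} {hZ : tf.monoidType = MonoidType.Z}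
  {hP : ∀ A : (ConnectedPart (BTemp X.Pi))ᵒᵖ, IsPerfect (tf.Φ.carrier A)}
  {NH : Subgroup (Field.absoluteGaloisGroup K) → tf.category → ℕ+ → Prop} {A₀ : tf.category}
  {hA₀ : PreFrobenioid.IsFrobeniusTrivial tf.toElem A₀} {hA₀' : SemiGraphs.IsGaloisObj A₀.base.obj}
  {lv N : ℕ+} {l' : ℕ} {RD : RigidData.{max u₀ w'} N l'}
  {pullFrac : ∀ {A A' : (BiKummerSetting.mkOfConnectedTemperoid X tf hZ hP NH A₀ hA₀ hA₀').C} (_ : A' ⟶ A),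
    (BiKummerSetting.mkOfConnectedTemperoid X tf hZ hP NH A₀ hA₀ hA₀').biratUnits A →
      (BiKummerSetting.mkOfConnectedTemperoid X tf hZ hP NH A₀ hA₀ hA₀').biratUnits A'}
  {θ : (BiKummerSetting.mkOfConnectedTemperoid X tf hZ hP NH A₀ hA₀ hA₀').biratUnits
    (BiKummerSetting.mkOfConnectedTemperoid X tf hZ hP NH A₀ hA₀ hA₀').Aodot}
  {Bl : (BiKummerSetting.mkOfConnectedTemperoid X tf hZ hP NH A₀ hA₀ hA₀').C}
  {Pl : (BiKummerSetting.mkOfConnectedTemperoid X tf hZ hP NH A₀ hA₀ hA₀').FractionPair θ Bl}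
  {Rl : (BiKummerSetting.mkOfConnectedTemperoid X tf hZ hP NH A₀ hA₀ hA₀').NthRoot θ Pl lv pullFrac}
  (h : ModelFrobenioid.Hypotheses tf.divisorMonoid tf.ratFnFunctor)
  (odd_l : Odd (lv : ℕ))
  (R : (BiKummerSetting.mkOfConnectedTemperoid X tf hZ hP NH A₀ hA₀ hA₀').NthRoot Rl.root Rl.pair N pullFrac)
  (ιX : RD.PiX ≃ₜ* X.Pi) (K' : Type (max u₀ w')) [Field K'] (constEmb : K'ˣ →* tf.biratUnitsModel R.BN)
  (constEmb_injective : Function.Injective constEmb)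
  (hinvc : ∀ g : Aut R.AN.base,
    pull tf.divisorMonoid g.hom (ModelFrobenioid.div R.pair.num) = ModelFrobenioid.div R.pair.num)
  (hinvp : ∀ y : RD.PiX, y ∈ RD.PiYdd →
    pull tf.divisorMonoid ((BiKummerSetting.mkOfConnectedTemperoid X tf hZ hP NH A₀ hA₀ hA₀').galoisSurj R.AN.base
      R.αData.isGalois (ιX y)).hom (ModelFrobenioid.div R.pair.den) = ModelFrobenioid.div R.pair.den)

/-- «`ι_N(μ_N) ⊆ q_N(ιX(Π^tp_Ÿ))`»: every `a ∈ μ_N` is `thetaMod g` for some `g ∈ l·Δ_Θ ⊆ Π^tp_Ÿ` (`RigidData.thetaMod_surjective`,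
`lDeltaTheta_le`), and `q_N (ιX g) = ι_N (thetaMod g)` (abc-iut-w4-d042's dictionary `qN_ιX_eq_iotaN_thetaMod`).
[cite: MochizukiEtTh2009, §1 p.238 (PDF p.12); §2 p.46] -/
theorem exists_mem_PiYdd_qN_eq_iotaN (a : RD.mu) : ∃ k ∈ RD.PiYdd, RD.qN ιX (ιX.toMonoidHom k) = RD.iotaN a := by
  obtain ⟨g, rfl⟩ := RD.thetaMod_surjective a
  exact ⟨g, (Subgroup.mem_inf.mp (RD.lDeltaTheta_le g.2)).1, RD.qN_ιX_eq_iotaN_thetaMod ιX (g : RD.PiX) g.2⟩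

/-- **`LDeltaCovered` at the genuine level-`N` data from the two pins ALONE** (any Frobenius-trivial Galois `A_⊙`): with `P` pinned at `B_N^bs`
to print's `Aut`-subquotient (`hPpre`: `P.pre = autPre q_N ι_N` read through `Aut_D(B_N^bs) ↪ Aut(B_N^bs.obj)`; `hPproj_pin`: `P.proj` IS
`autProj` there — abc-iut-w4-d042's pins, VERBATIM as in p448631 / p450400), the part of `H_{B_N} = ρ(Π^tp_Ÿ)` over `(l·Δ_Θ)_{B_N}` maps ONTO
`(l·Δ_Θ)_{B_N} ⊗ ℤ/N` — abc-iut-w5-d020's `Thm56Sub.LDeltaCovered`, the one K4-side residual of my `kummerComparison_of_thetaSectionCompat_of_rigidity`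
(p458989).  [cite: MochizukiEtTh2009, Prop 5.5 proof p.327–328 (PDF pp.101–102); §1 p.238 (PDF p.12)] -/
theorem lDeltaCovered_levelStub_of_pins [RD.iotaN.range.Normal]
    (P : ThetaSubquotientProj (ofConnectedTemperoidData h (RD.levelStub ιX) odd_l R ιX K' constEmb constEmb_injective hinvc hinvp))
    (hPpre : P.pre R.BN.base =
      (ThetaSubquotient.autPre (RD.qN ιX) RD.iotaN R.BN.base.obj).comap (Functor.mapAut R.BN.base (connectedObjects (BTemp X.Pi)).ι))
    (hPproj_pin : ∀ (σ : P.pre R.BN.base) (τ : ThetaSubquotient.autPre (RD.qN ιX) RD.iotaN R.BN.base.obj),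
      Functor.mapAut R.BN.base (connectedObjects (BTemp X.Pi)).ι (σ : Aut R.BN.base) = (τ : Aut R.BN.base.obj) →
        (P.proj R.BN.base σ : ThetaSubquotient.LDelta (RD.qN ιX) RD.iotaN R.BN.base.obj) =
          ThetaSubquotient.autProj (RD.qN ιX) RD.iotaN R.BN.base.obj τ) :
    Thm56Sub.LDeltaCovered (ofConnectedTemperoidData h (RD.levelStub ιX) odd_l R ιX K' constEmb constEmb_injective hinvc hinvp) P := by
  intro x
  induction x using QuotientGroup.induction_on with
  | H c =>
    obtain ⟨k, hk, hm, hc⟩ := exists_autProj_mapAut_rhoOfBiKummerData_eq R ιX (RD.qN ιX) RD.iotaN RD.PiYdd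
      (exists_mem_PiYdd_qN_eq_iotaN ιX) c
    have hpre : rhoOfBiKummerData R ιX k ∈ P.pre R.BN.base := by
      rw [hPpre]
      exact hm
    refine ⟨⟨rhoOfBiKummerData R ιX k, Subgroup.mem_map_of_mem _ hk⟩, hpre, ?_⟩
    exact congrArg QuotientGroup.mk ((hPproj_pin ⟨_, hpre⟩ ⟨_, hm⟩ rfl).trans hc)

end LevelN

end ThetaFrobenioid

end Literature.AnabelianGeometry.EtaleTheta

end
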